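import Summits.BirchSwinnertonDyer.Rank1Residual.Additive.N10LowerHalfIwasawa
import Summits.BirchSwinnertonDyer.Rank1Residual.Additive.ChiBranchLowerTransport
import HarnessLib
import HarnessLib.Audit.Tags

/-!
# N10, cell (G-ord, `e = 2`), analytic rank `0`: the TWIST-TRANSPORT identity with its ONE announced
# input named — Burungale–Skinner–Tian–Wan Thm. 9.21(c) [= "1.21(c)", historical label], twist clause (cell `bsd-addord`, seat
# `bsd-addord-twist`, strategy = twist transport; FULL-BSD rank-≤1 programme D-0033, tranche 1a)

HONEST FRAMING (cell `bsd-addord`, `run/shared/lean/pub/bsd-addord/README.md` §4, verbatim in spirit):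
the programme's target of record is the full Birch–Swinnerton-Dyer formula for every `E/ℚ` of
analytic rank `≤ 1`; this file concerns ONE cell of the complement — class N10 of the residual map
(the LOWER half `ord_p #Ш_an ≤ ord_p #Ш` at an additive, potentially good ORDINARY prime of Kodaira
type `I₀*`, analytic rank `0`) — and it books NOTHING: the one Iwasawa-theoretic input is an
UNREFEREED, SKETCH-PROVED claim, typed below as an explicit OPEN hypothesis (never a `_holds`), exactly
as the tree already does for the same preprint's Thm. 1.3 (`BurungaleSkinnerTianWan2024_thm13_OPEN`,
`Supersingular/KobayashiMainConjecture.lean`). N10 stays CONSTRUCTION-shaped. One definition (the OPEN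
hypothesis) and bookkeeping theorems; no named fact is minted; every published input is an explicit
named-fact binder of the tree.

## The identity (seat purpose: "BSD_p(E) ⇐ [IMC-shaped lower bound for E ⊗ χ at a prime where E ⊗ χ is
## semistable] + [Tamagawa/period/Selmer transport along χ]")

Let `(E, p)` lie in cell (G-ord, `e = 2`) of N10 (`N10.CellGordTwo W p`: `p` odd, additive, Delbourgo
type (G)-ordinary, semistability index `2`). Then `E = E♭ ⊗ χ_K` with `K = ℚ(√p*)`, `χ_K = (·/p) =
ω^{(p−1)/2}`, and `E♭ = E^{(p*)}` has GOOD ORDINARY reduction at `p` (tree: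
`TypeGOrd.exists_goodOrd_model_twist_pStar`). The transport along `χ_K` is PROVED in the tree:
* period / `L`-value: `L(E,1)/Ω_E = ±ϖ·∑_{a mod p}(a/p)[a/p]^±_{f♭}` (Birch, MTT 1986 §I.8 + Pal 2012
  Thm. 3.2; `ChiBranchLowerTransport[Gord].lean`: the `χ_K`-branch value of `E♭`'s modular symbol at
  `T = 0` IS the cyclotomic leading value of `E`; `CycLowerLeadingTermAt W p ⟺ ChiBranchLowerLeadingTermAt W p`
  on these rows);
* Selmer / Tamagawa: Delbourgo's control at the unstable prime — `X(E/ℚ_∞)` at `T = 0` against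
  `#Ш(E)·∏_{ℓ≠p} c_ℓ(E)·ℓ_p(E)/#E(ℚ)_tors²` (Delbourgo 2002 Thm. (A)+(B), named fact
  `Delbourgo2002.mainTheorem`; `ℓ_p(E) = 1` off the anomalous rows) — consumed by
  `N10.missingLowerBoundAt_of_cycLowerLeadingTerm_of_nonAnomalous` (`N10LowerHalfIwasawa.lean`);
* the UPPER half on the same rows is a kernel theorem (Kato 2004 Thm. 17.4 on the `χ_K`-component,
  `ClassX4Gord.bsdp_rankZero_of_katoComponent_of_lower`; no Tamagawa, no Manin hypothesis).
So `BSD(E,p)` on the cell is EXACTLY the Iwasawa-currency LOWER input `CycLowerLeadingTermAt W p`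
("for every generator `f` of `char_Λ X(E/ℚ_∞)`, `L(E,1)/Ω_E ∣ f(0)` in `ℤ_p`") — the `T = 0` shadow
of the divisibility `char_Λ X ⊆ (L_p)` on the `ω^{(p−1)/2}`-branch of the cyclotomic main conjecture
of `E♭`, equivalently of Kato's main conjecture (Astérisque 295, Conj. 12.10) for the newform
`f_E = f_{E♭} ⊗ χ_K` itself.

## The ONE input, as announced (held text `paper:arxiv-2409.01350`, v2, p0072 L129 – p0073 L83)

Burungale–Skinner–Tian–Wan, *Zeta elements for elliptic curves and applications*, arXiv:2409.01350v2,
Thm. 9.21 (c) (§9.4.1, arXiv v2 PDF p. 84; printed as "1.21 (c)" in the held TeX chunking — see §3): "Let `p ∤ 6N` be an ordinary prime such that (irr_ℚ) holds. Then we have an equality of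
ideals `ξ(H¹(ℤ[1/p], T ⊗ Λ)/Λ·z_γ(g)) = ξ(X_st(g))` in `Λ ⊗ ℚ_p`, which is an equality in `Λ` for
primes `p ∤ 2N` if (ram) holds. **Moreover, the equality also holds for the quadratic twist
`g_K := g ⊗ χ_K`, where `K/ℚ` is a quadratic field extension with `p ∣ disc(K)` so that (ram_K):
there exists a prime `ℓ ∤ D_K` as in (ram).**" Its printed proof is a sketch (p0073 L44–83: "`g_K` is
nearly ordinary … the Eisenstein congruence method of Skinner–Urban [SU] applies … triple product
period [Hs1] instead of the Rankin–Selberg period … instead of the vanishing of the anticyclotomic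
`μ`-invariant [Va] we utilise a non-vanishing result of Hung [Hu] … the latter does not explicitly
cover our setting, however the same argument applies"). STATUS: PRE (no journal version located
2026-08-25). DICTIONARY with the cell (checked in `run/shared/lean/b2b/bsd-rank1-residual/
b2b-bsdres-additive-p2/BSTW121C-X4GORD.md` §2 and re-derived in the seat's memo §1): `g = f_{E♭}`,
`N = N_E/p²`, so `p ∤ 6N ⟺ p ≥ 5`; "ordinary" ⟺ (G-ord); (irr_ℚ) for `ρ̄_g = ρ̄_E ⊗ χ_K ⟺ Irr W p`
(class X4); (ram_K) ⟺ `Ram W p` (a prime `ℓ ≠ p`, `ℓ ‖ N_E`, `p ∤ v_ℓ(Δ_min)`: twisting by `χ_K` is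
unramified at `ℓ`); conclusion = Kato's main conjecture for `f_E`, integrally.

## What is typed, and the joint it carries (R4 honest note)

`BurungaleSkinnerTianWan2024_thm121c_twist_cycLower_OPEN` is the READING of the twist clause at
`T = 0` in the tree's Iwasawa currency: on the slice {`p ≥ 5`, `r_an = 0`, `N10.CellGordTwo`, `Irr`,
`Ram`}, `CycLowerLeadingTermAt W p`. Between the printed Kato-form equality and this reading sits the
JOINT [C]: Kato-form ⟹ Greenberg–Delbourgo form on the `χ_K`-branch (the four-term Poitou–Tate
sequence `0 → H¹_Iw(T)/Λz → H¹_{/f}(ℚ_p)/Col⁻¹(L_p) → X_Gr → X_st → 0` with Kato's reciprocity law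
Thm. 16.6 on `ℚ(μ_{p^∞})` projected to the `ω^{(p−1)/2}`-eigenspace; the Kato direction of the same
sequence is how the tree's branch-component facts `Kato2004.charIdeal_dvd_padicLFunctionBranch_component_*`
are read; Delbourgo 1998 §2 / 2002 §3 identify `X_Gr` on the branch with `X(E/ℚ_∞)`). [C] is folklore,
not a printed sentence for an unstable prime; the seat's memo (§2, REPAIR CENSUS row J2) records it as
the second unproved joint. NOTHING in this file asserts either.

## What the theorems give (all modulo the OPEN hypothesis; census of record, not re-derived)

* `N10.missingLowerBoundAt_cellGordTwo_of_BSTW121c_twist_OPEN`: the lower half on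
  (G-ord, `e = 2`) ∩ X4 ∩ {`p ≥ 5`, `r_an = 0`, `Ram`, non-CM, non-anomalous};
* `N10.bsdp_cellGordTwo_of_BSTW121c_twist_OPEN_of_surj`: Miller's `BSD(E,p)` there, given `ρ̄` onto
  (Kato component `hK`, Delbourgo 1998 Prop. 4 `hDel98`, Delbourgo 2002 `hDel`, `hmodD`, GZK,
  modularity) — NO Tamagawa, NO Manin hypothesis, so it reaches the Tamagawa-obstructed rows that the
  Kurihara-number route (`X4/KuriharaClasswide`) provably cannot;
* on the anomalous rows the same input leaves `ord_p #Ш_an ≤ ord_p #Ш + 2`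
  (`N10.padicValRat_shaAn_le_add_two_of_BSTW121c_twist_OPEN`).
Window census (additive-p2 `census/bstw121c_census.py`, `N < 2·10⁴ ‖ 10⁴`): X4♯(G-ord, `e = 2`,
`p ≥ 5`) ∧ (ram) = 218 ‖ 45 pairs, `r = 0`: 214 ‖ 44 (all `ρ̄` onto), CORE-open 17 ‖ 3 (14 with
`p ∣ ∏ c_ℓ`, 3 with `p² ∣ #Ш_an`); sweep of record (RESIDUAL-MAP §I N10): X4 `r = 0` (G-ord, `e = 2`,
`p ≥ 5`) 3 179 S-b pairs.

## What this is NOT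

Not a proof of anything about a single curve's `Ш` without the OPEN hypothesis; not a verification of
BSTW's sketch (the seat's memo lists the eleven SU steps it touches and what is unverified); not the
(M) cell (`p ‖ N_g` is outside "`p ∤ 6N`"; no source announces it), not the X3 rows (`(irr_ℚ)` fails),
not `e ∈ {3,4,6}` (`f_E` is not a quadratic twist of an ordinary form), not `p = 3`, not rank `1`;
the anomalous / CM rows keep the Miller-currency statement `N10.LowerHalfGordTwo` as their residue.

References: A. Burungale, C. Skinner, Y. Tian, X. Wan, arXiv:2409.01350v2 Thm. 9.21(c) (§9.4.1, PDF p. 84; "1.21(c)" = historical label)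
[BurungaleSkinnerTianWan2024]; D. Delbourgo, J. Number Theory 95 (2002) Thm. (A), (B) [Delbourgo2002];
D. Delbourgo, Compositio Math. 113 (1998) Prop. 4, Main Conjecture p. 151 [Delbourgo1998]; K. Kato,
Astérisque 295 (2004) Conj. 12.10, Thm. 16.6, Thm. 17.4 [Kato2004Asterisque]; C. Skinner, E. Urban,
Invent. Math. 195 (2014) Thm. 3.6.1, Cor. 3.6.2–3.6.3 [SkinnerUrban2014]; V. Pal, Proc. AMS 140 (2012)
Thm. 3.2 [Pal2012]; R. L. Miller, LMS J. Comput. Math. 14 (2011) Def. 1.1 [Miller2011LMS].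
-/

noncomputable section

open scoped Classical

open WeierstrassCurve Literature.NumberTheory.EllipticCurves
  Literature.NumberTheory.EllipticCurves.ModularForms
  Literature.NumberTheory.EllipticCurves.Rank1Residual
  Literature.NumberTheory.EllipticCurves.Rank1Residual.Typed

namespace Summit.BirchSwinnertonDyer.Rank1Residual.Additive

/-! ## §1 The announced input, typed as an OPEN hypothesis (its `T = 0` reading in the tree's currency) -/

/-- **OPEN HYPOTHESIS — UNREFEREED PREPRINT (Burungale–Skinner–Tian–Wan, arXiv:2409.01350v2),
Thm. 9.21(c) (§9.4.1, arXiv v2 PDF p. 84; "121c" in the name = historical label), TWIST CLAUSE, read at `T = 0` on the `χ_{p*}`-branch.** Printed: for `g ∈ S₂(Γ₀(N))`,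
`p ∤ 6N` ordinary, (irr_ℚ), and `K/ℚ` quadratic with `p ∣ disc(K)` and (ram_K), Kato's main conjecture
holds integrally for `g_K = g ⊗ χ_K`. Transcribed on the N10 cell through the dictionary `g = f_{E♭}`,
`E♭ = E^{(p*)}` good ordinary, `g_K = f_E` (module docstring): for `W` globally minimal, `p ≥ 5`,
`ord_{s=1} L(E,s) = 0`, `(E,p)` in cell (G-ord, `e = 2`) (`N10.CellGordTwo`), `E[p]` irreducible
(`Irr`) and a (ram) prime `ℓ ≠ p` (`Ram`) ⇒ the Iwasawa-currency lower input `CycLowerLeadingTermAt W p`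
(for every generator `f` of `char_Λ X(E/ℚ_∞)`, `L(E,1)/Ω_E ∣ f(0)` in `ℤ_p`). This READING composes
the printed claim with the joint [C] (Kato form ⟹ Greenberg–Delbourgo form on the branch, module
docstring); both are unproved here. NEVER cite this `Prop` as a theorem; take it as an explicit
hypothesis. [claim: BurungaleSkinnerTianWan2024, status: under-review] -/
def BurungaleSkinnerTianWan2024_thm121c_twist_cycLower_OPEN : Prop :=
  ∀ (W : WeierstrassCurve ℚ) [W.IsElliptic] [W.IsGloballyMinimal] (p : ℕ) [Fact p.Prime],
    5 ≤ p → W.analyticRank = 0 → N10.CellGordTwo W p → Irr W p → Ram W p →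
    CycLowerLeadingTermAt W p

/-! ## §2 Consequences on the cell (bookkeeping against the kernel's consumers of record) -/

section Consequences

variable (W : WeierstrassCurve ℚ) [W.IsElliptic] [W.IsGloballyMinimal] (p : ℕ) [hp : Fact p.Prime]

/-- The OPEN hypothesis at a pair of the slice delivers the decl of record `CycLowerLeadingTermAt W p`
(instantiation). [claim: BurungaleSkinnerTianWan2024, status: under-review] -/
theorem N10.cycLowerLeadingTermAt_of_BSTW121c_twist_OPEN
    (hO : BurungaleSkinnerTianWan2024_thm121c_twist_cycLower_OPEN)
    (hp5 : 5 ≤ p) (hr : W.analyticRank = 0) (hc : N10.CellGordTwo W p) (hirr : Irr W p)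
    (hram : Ram W p) : CycLowerLeadingTermAt W p :=
  hO W p hp5 hr hc hirr hram

/-- **The identity, LOWER half.** IF the twist clause of BSTW Thm. 9.21(c) (read at `T = 0`, `hO`)
holds, then on cell (G-ord, `e = 2`) ∩ X4 ∩ {`p ≥ 5`, `r_an = 0`, (ram), non-CM, non-anomalous}
the lower half `ord_p #Ш(E)_an ≤ ord_p #Ш(E)` holds — through Delbourgo's control at the unstable
prime (Delbourgo 2002 Thm. (A)+(B), `hDel`; `ℓ_p(E) = 1` off the anomalous rows), GZK and modularity
(`N10.missingLowerBoundAt_of_cycLowerLeadingTerm_of_nonAnomalous`). Conditional on an unrefereed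
claim; nothing booked. [claim: BurungaleSkinnerTianWan2024, status: under-review]
[cite: Delbourgo2002, Theorem (A), (B) (p. 40), p. 39 (ℓ_p(E))] [cite: Miller2011LMS, Def. 1.1] -/
theorem N10.missingLowerBoundAt_cellGordTwo_of_BSTW121c_twist_OPEN
    (hO : BurungaleSkinnerTianWan2024_thm121c_twist_cycLower_OPEN)
    (hDel : Delbourgo2002.mainTheorem)
    (hGZK : rank_eq_analyticRank_of_analyticRank_le_one) (hmod : hasEntireLFunction_rat)
    (hp5 : 5 ≤ p) (hr : W.analyticRank = 0) (hc : N10.CellGordTwo W p) (hirr : Irr W p)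
    (hram : Ram W p) (hcm : ¬ W.HasCM) (hna : Delbourgo2002.ReductionNonAnomalous W p) :
    MissingLowerBoundAt W p :=
  N10.missingLowerBoundAt_of_cycLowerLeadingTerm_of_nonAnomalous W p hDel hGZK hmod hp5 hcm hc.2.1
    hc.2.2.1 hr hna (hO W p hp5 hr hc hirr hram)

/-- **The identity, `BSD(E,p)`.** IF the twist clause (`hO`) holds, then on cell (G-ord, `e = 2`) ∩
{`p ≥ 5`, `r_an = 0`, `ρ̄_{E,p}` onto, (ram), non-CM, non-anomalous} Miller's `BSD(E,p)` holds: the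
lower half from `hO` (previous theorem), the UPPER half from the kernel's Kato-component reading on the
`χ_{p*}`-branch (`hK`, Kato 2004 Thm. 17.4) with Delbourgo 1998 Prop. 4 (`hDel98`) and a modular
parametrisation datum (`hmodD`) — `ClassX4Gord.bsdp_rankZero_of_katoComponent_of_lower`. NO Tamagawa
and NO Manin hypothesis: the Tamagawa-obstructed rows of the cell are INSIDE this statement.
Conditional on an unrefereed claim; nothing booked. [claim: BurungaleSkinnerTianWan2024, status: under-review]
[cite: Kato2004Asterisque, Thm. 17.4 (3) (p. 273)] [cite: Delbourgo1998, Prop. 4 (p. 144)]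
[cite: Delbourgo2002, Theorem (A), (B) (p. 40)] [cite: Miller2011LMS, §1 and Def. 1.1] -/
theorem N10.bsdp_cellGordTwo_of_BSTW121c_twist_OPEN_of_surj
    (hO : BurungaleSkinnerTianWan2024_thm121c_twist_cycLower_OPEN)
    (hDel : Delbourgo2002.mainTheorem)
    (hK : Kato2004.charIdeal_dvd_padicLFunctionBranch_component_of_surjective)
    (hDel98 : Delbourgo1998.prop4_rankZero_pow_dvd_constantCoeff)
    (hGZK : rank_eq_analyticRank_of_analyticRank_le_one) (hmod : hasEntireLFunction_rat)
    (hmodD : nonempty_modularParametrizationData)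
    (hp5 : 5 ≤ p) (hr : W.analyticRank = 0) (hc : N10.CellGordTwo W p) (hsurj : Surj W p)
    (hram : Ram W p) (hcm : ¬ W.HasCM) (hna : Delbourgo2002.ReductionNonAnomalous W p) :
    BSDp W p :=
  have hirr : Irr W p := hasIrreducibleModPGaloisRep_of_hasSurjectiveModNGaloisRep W p hsurj
  ClassX4Gord.bsdp_rankZero_of_katoComponent_of_lower hK hDel98 hGZK hmod hmodD
    ⟨⟨hc.1, hc.2.1, hirr⟩, hc.2.2.1⟩ hc.2.2.2 hr hsurj (fun _ ↦ hram)
    (N10.missingLowerBoundAt_cellGordTwo_of_BSTW121c_twist_OPEN W p hO hDel hGZK hmod hp5 hr hc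
      hirr hram hcm hna)

/-- **On the anomalous rows** (`ℓ_p(E) ∣ p²` possibly `≠ 1`) the twist clause still bounds the
residue: `#Ш(E)_an = q` with `ord_p q ≤ ord_p #Ш(E) + 2`. [claim: BurungaleSkinnerTianWan2024, status: under-review]
[cite: Delbourgo2002, Theorem (A), (B) (p. 40), p. 39 (ℓ_p(E))] -/
theorem N10.padicValRat_shaAn_le_add_two_of_BSTW121c_twist_OPEN
    (hO : BurungaleSkinnerTianWan2024_thm121c_twist_cycLower_OPEN)
    (hDel : Delbourgo2002.mainTheorem)
    (hGZK : rank_eq_analyticRank_of_analyticRank_le_one) (hmod : hasEntireLFunction_rat)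
    (hp5 : 5 ≤ p) (hr : W.analyticRank = 0) (hc : N10.CellGordTwo W p) (hirr : Irr W p)
    (hram : Ram W p) (hcm : ¬ W.HasCM) :
    ∃ q : ℚ, shaAn W = (q : ℂ) ∧ padicValRat p q ≤ padicValNat p W.shaOrder + 2 :=
  N10.padicValRat_shaAn_le_add_two_of_cycLowerLeadingTerm W p hDel hGZK hmod hp5 hcm hc.2.1 hc.2.2.1
    hr (hO W p hp5 hr hc hirr hram)

end Consequences

/-- **Slice form.** IF the twist clause (`hO`) holds, then the conjecture `N10.LowerHalfGordTwo`
holds on the slice {`p ≥ 5`, `Irr`, `Ram`, non-CM, non-anomalous} of its cell — binder for binder the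
`∀`-closure the consumers of `N10LowerHalfResidue.lean` take. The complement of the slice inside the
cell (X3 rows, no-(ram) rows, CM, anomalous, `p = 3`) keeps `N10.LowerHalfGordTwo` as its typed
residue. [claim: BurungaleSkinnerTianWan2024, status: under-review] [cite: Delbourgo2002, Theorem (A), (B) (p. 40)] -/
theorem N10.lowerHalfGordTwo_slice_of_BSTW121c_twist_OPEN
    (hO : BurungaleSkinnerTianWan2024_thm121c_twist_cycLower_OPEN)
    (hDel : Delbourgo2002.mainTheorem)
    (hGZK : rank_eq_analyticRank_of_analyticRank_le_one) (hmod : hasEntireLFunction_rat) :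
    ∀ (W : WeierstrassCurve ℚ) [W.IsElliptic] [W.IsGloballyMinimal] (p : ℕ) [Fact p.Prime],
      W.analyticRank = 0 → N10.CellGordTwo W p → 5 ≤ p → Irr W p → Ram W p → ¬ W.HasCM →
      Delbourgo2002.ReductionNonAnomalous W p → MissingLowerBoundAt W p :=
  fun W _ _ p _ hr hc hp5 hirr hram hcm hna ↦
    N10.missingLowerBoundAt_cellGordTwo_of_BSTW121c_twist_OPEN W p hO hDel hGZK hmod hp5 hr hc hirr
      hram hcm hna

/-! ## §3 (appended 2026-08-25) Locator erratum: "Thm. 1.21(c)" = Theorem 9.21(c) of arXiv:2409.01350v2 -/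

/-- **Locator erratum and correctly numbered alias.** The twist clause cited throughout this file as
"Thm. 1.21(c)" of Burungale–Skinner–Tian–Wan, arXiv:2409.01350v2, is **Theorem 9.21(c)** (§9.4.1
"Kato's main conjecture", PDF p. 84; proof sketch pp. 84–85; Remark 9.22 "(ram) implies (im)"; Cor. 9.23
carries no twist clause); likewise "Lemma 1.16/1.17, Prop. 1.18" of the seat's memo are Lemma 9.16/9.17,
Prop. 9.18 of §9.3. The held TeX text (`paper:arxiv-2409.01350`, chunk p0073) flattens the §9 counter
to "1.21", which the predecessor cell's note BSTW121C-X4GORD.md and §§1–2 above inherited (located by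
the cell's literature seat, `run/shared/lean/pub/bsd-addord/STATUS.md` 2026-08-25T09:02:49Z). The
STATEMENT transcribed in §1 is unchanged; this `abbrev` is the same `Prop` under the corrected number,
for citation by new consumers. NEVER cite it as a theorem; take it as an explicit hypothesis.
[claim: BurungaleSkinnerTianWan2024, status: under-review] -/
abbrev BurungaleSkinnerTianWan2024_thm921c_twist_cycLower_OPEN : Prop :=
  BurungaleSkinnerTianWan2024_thm121c_twist_cycLower_OPEN

/-- The two names denote the same hypothesis (definitional). [claim: BurungaleSkinnerTianWan2024, status: under-review] -/
theorem BurungaleSkinnerTianWan2024_thm921c_twist_cycLower_OPEN_iff :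
    BurungaleSkinnerTianWan2024_thm921c_twist_cycLower_OPEN ↔
      BurungaleSkinnerTianWan2024_thm121c_twist_cycLower_OPEN :=
  Iff.rfl

/-! ## §4 (appended 2026-08-25) The Λ-ADIC reading of the twist clause on the `χ_p`-branch (`p ≡ 1 (mod 4)`) — the
hook for the rank-one "O7 twin" (cell planner, TARGET.md v2 §8) and a second derivation of §2 on those rows

BSTW Thm. 9.21(c) asserts an equality of characteristic ideals in `Λ`, not only its `T = 0` shadow. In the
tree's Λ-adic currency on the `χ_p = ω^{(p−1)/2}`-branch — available for `p ≡ 1 (mod 4)` (PLUS symbols):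
`ChiBranchLowerDivisibilityAt W p` (`Additive/ChiBranchLowerInput.lean`: for every good-ordinary twist
datum `(V, f, ϖ)` and every dual datum `D` of `Sel_{p^∞}(W/ℚ_∞)`, `char_Λ X(W/ℚ_∞) ⊆ (ϖ·L_p(f, α,
ω^{(p−1)/2}, T))·Λ`) — the reading [I]∘[C] is the `Prop` below. It is RANK-FREE, so the gz seat's
rank-one chain (twisted-branch `p`-adic Gross–Zagier ⟹ `CycLowerBoundAt`) can take it as its displayed
hypothesis; at `T = 0` it re-derives §1's reading on the `p ≡ 1 (mod 4)` rows through the tree's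
`chiBranchLowerLeadingTermAt_of_divisibility_of_padicValRat_j_nonneg` and
`cycLowerLeadingTermAt_iff_chiBranchLower_of_typeGOrd_of_semistabilityIndex_eq_two` (Pal 2012 Thm. 3.2,
named fact `hPal`). For `p ≡ 3 (mod 4)` the tree has no Λ-adic branch currency yet (only the `T = 0`
form `ChiBranchLowerLeadingTermOddAt`); those rows keep §1. Nothing asserted; nothing booked. -/

/-- **OPEN HYPOTHESIS — BSTW arXiv:2409.01350v2 Thm. 9.21(c), TWIST CLAUSE, read Λ-ADICALLY on the
`χ_p`-branch (`p ≡ 1 (mod 4)`).** On the slice {`p ≥ 5`, `p ≡ 1 (mod 4)`, `(E,p)` in cell (G-ord, `e = 2`)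
(`N10.CellGordTwo`), `E[p]` irreducible, a (ram) prime `ℓ ≠ p`}: `ChiBranchLowerDivisibilityAt W p`, i.e.
`char_Λ X(E/ℚ_∞) ⊆ (L_p(E))` with `L_p(E)` the `ω^{(p−1)/2}`-branch of the Mazur–Swinnerton-Dyer measure
of `E♭ = E^{(p)}` in Néron normalisation — Kato's main conjecture for `f_E` (the printed claim) carried
to Greenberg–Delbourgo form by joint [C] (module docstring). No rank hypothesis. NEVER cite this `Prop`
as a theorem; take it as an explicit hypothesis. [claim: BurungaleSkinnerTianWan2024, status: under-review] -/
def BurungaleSkinnerTianWan2024_thm921c_twist_chiBranchLowerDivisibility_OPEN : Prop :=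
  ∀ (W : WeierstrassCurve ℚ) [W.IsElliptic] [W.IsGloballyMinimal] (p : ℕ) [Fact p.Prime],
    5 ≤ p → p % 4 = 1 → N10.CellGordTwo W p → Irr W p → Ram W p →
    ChiBranchLowerDivisibilityAt W p

section LambdaAdic

variable (W : WeierstrassCurve ℚ) [W.IsElliptic] [W.IsGloballyMinimal] (p : ℕ) [hp : Fact p.Prime]

/-- The Λ-adic reading at a pair of its slice: `ChiBranchLowerDivisibilityAt W p` — the displayed
hypothesis the rank-one chain consumes (rank-free). [claim: BurungaleSkinnerTianWan2024, status: under-review] -/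
theorem N10.chiBranchLowerDivisibilityAt_of_BSTW921c_twist_OPEN
    (hΛ : BurungaleSkinnerTianWan2024_thm921c_twist_chiBranchLowerDivisibility_OPEN)
    (hp5 : 5 ≤ p) (hp4 : p % 4 = 1) (hc : N10.CellGordTwo W p) (hirr : Irr W p) (hram : Ram W p) :
    ChiBranchLowerDivisibilityAt W p :=
  hΛ W p hp5 hp4 hc hirr hram

/-- **Λ-adic ⟹ `T = 0`**: on its slice the Λ-adic reading gives the decl of record
`CycLowerLeadingTermAt W p` (the `T = 0` currency of §1), through the tree's
`chiBranchLowerLeadingTermAt_of_divisibility_of_padicValRat_j_nonneg` (`ord_p j ≥ 0` on (G-ord):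
`padicValRat_j_nonneg_of_typeGOrd`) and `cycLowerLeadingTermAt_iff_chiBranchLower_of_typeGOrd_of_semistabilityIndex_eq_two`
(Birch + Pal 2012 Thm. 3.2 `hPal`, modularity `hmod`, a parametrisation datum `hmodD`).
[claim: BurungaleSkinnerTianWan2024, status: under-review] [cite: Pal2012, Thm. 3.2]
[cite: MazurTateTeitelbaum1986Invent, §I.8 (8.6) and §I.14] -/
theorem N10.cycLowerLeadingTermAt_of_BSTW921c_twist_chiBranch_OPEN
    (hΛ : BurungaleSkinnerTianWan2024_thm921c_twist_chiBranchLowerDivisibility_OPEN)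
    (hPal : Pal2012.thm32_sqrt_mul_realPeriodRat_twist_eq_of_prime_one_mod_four)
    (hmod : hasEntireLFunction_rat) (hmodD : nonempty_modularParametrizationData)
    (hp5 : 5 ≤ p) (hp4 : p % 4 = 1) (hc : N10.CellGordTwo W p) (hirr : Irr W p) (hram : Ram W p) :
    CycLowerLeadingTermAt W p :=
  (cycLowerLeadingTermAt_iff_chiBranchLower_of_typeGOrd_of_semistabilityIndex_eq_two W p hPal hmod hmodD
      hp4 hc.2.1 hc.2.2.1 hc.2.2.2).mpr
    (chiBranchLowerLeadingTermAt_of_divisibility_of_padicValRat_j_nonneg p W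
      (padicValRat_j_nonneg_of_typeGOrd W p hc.2.2.1) (hΛ W p hp5 hp4 hc hirr hram))

/-- **Λ-adic ⟹ the lower half in rank `0`** on the `p ≡ 1 (mod 4)` rows of the slice, off the CM and
anomalous rows (Delbourgo 2002 (A)+(B) `hDel`, GZK, modularity) — the `p ≡ 1 (mod 4)` half of
`N10.missingLowerBoundAt_cellGordTwo_of_BSTW121c_twist_OPEN` re-derived from the Λ-adic reading.
[claim: BurungaleSkinnerTianWan2024, status: under-review] [cite: Delbourgo2002, Theorem (A), (B) (p. 40)]
[cite: Pal2012, Thm. 3.2] [cite: Miller2011LMS, Def. 1.1] -/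
theorem N10.missingLowerBoundAt_cellGordTwo_of_BSTW921c_twist_chiBranch_OPEN
    (hΛ : BurungaleSkinnerTianWan2024_thm921c_twist_chiBranchLowerDivisibility_OPEN)
    (hPal : Pal2012.thm32_sqrt_mul_realPeriodRat_twist_eq_of_prime_one_mod_four)
    (hDel : Delbourgo2002.mainTheorem)
    (hGZK : rank_eq_analyticRank_of_analyticRank_le_one) (hmod : hasEntireLFunction_rat)
    (hmodD : nonempty_modularParametrizationData)
    (hp5 : 5 ≤ p) (hp4 : p % 4 = 1) (hr : W.analyticRank = 0) (hc : N10.CellGordTwo W p)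
    (hirr : Irr W p) (hram : Ram W p) (hcm : ¬ W.HasCM) (hna : Delbourgo2002.ReductionNonAnomalous W p) :
    MissingLowerBoundAt W p :=
  N10.missingLowerBoundAt_of_cycLowerLeadingTerm_of_nonAnomalous W p hDel hGZK hmod hp5 hcm hc.2.1
    hc.2.2.1 hr hna
    (N10.cycLowerLeadingTermAt_of_BSTW921c_twist_chiBranch_OPEN W p hΛ hPal hmod hmodD hp5 hp4 hc hirr hram)

/-- **Λ-adic ⟹ `BSD(E,p)` in rank `0`** on the `p ≡ 1 (mod 4)` rows of the slice with `ρ̄_{E,p}` onto,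
off CM/anomalous (upper half: Kato `χ_p`-component `hK`, Delbourgo 1998 Prop. 4 `hDel98`; Tamagawa- and
Manin-free). [claim: BurungaleSkinnerTianWan2024, status: under-review] [cite: Kato2004Asterisque, Thm. 17.4 (3) (p. 273)]
[cite: Delbourgo1998, Prop. 4 (p. 144)] [cite: Delbourgo2002, Theorem (A), (B) (p. 40)] [cite: Miller2011LMS, §1 and Def. 1.1] -/
theorem N10.bsdp_cellGordTwo_of_BSTW921c_twist_chiBranch_OPEN_of_surj
    (hΛ : BurungaleSkinnerTianWan2024_thm921c_twist_chiBranchLowerDivisibility_OPEN)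
    (hPal : Pal2012.thm32_sqrt_mul_realPeriodRat_twist_eq_of_prime_one_mod_four)
    (hDel : Delbourgo2002.mainTheorem)
    (hK : Kato2004.charIdeal_dvd_padicLFunctionBranch_component_of_surjective)
    (hDel98 : Delbourgo1998.prop4_rankZero_pow_dvd_constantCoeff)
    (hGZK : rank_eq_analyticRank_of_analyticRank_le_one) (hmod : hasEntireLFunction_rat)
    (hmodD : nonempty_modularParametrizationData)
    (hp5 : 5 ≤ p) (hp4 : p % 4 = 1) (hr : W.analyticRank = 0) (hc : N10.CellGordTwo W p)
    (hsurj : Surj W p) (hram : Ram W p) (hcm : ¬ W.HasCM) (hna : Delbourgo2002.ReductionNonAnomalous W p) :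
    BSDp W p :=
  have hirr : Irr W p := hasIrreducibleModPGaloisRep_of_hasSurjectiveModNGaloisRep W p hsurj
  ClassX4Gord.bsdp_rankZero_of_katoComponent_of_lower hK hDel98 hGZK hmod hmodD
    ⟨⟨hc.1, hc.2.1, hirr⟩, hc.2.2.1⟩ hc.2.2.2 hr hsurj (fun _ ↦ hram)
    (N10.missingLowerBoundAt_cellGordTwo_of_BSTW921c_twist_chiBranch_OPEN W p hΛ hPal hDel hGZK hmod hmodD
      hp5 hp4 hr hc hirr hram hcm hna)

end LambdaAdic

end Summit.BirchSwinnertonDyer.Rank1Residual.Additive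

end
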